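import Summits.NavierStokesRegularity.NavierStokesRegularity.Theorems.SelfMixingDichotomyCoherentScaleExclusionTypeIRegime
import HarnessLib

/-!
# Route SelfMixingDichotomy — crux `CoherentScaleExclusion` (S2, item 1423), regimes (I)/(B)
# `stub_cknC_ceiling_of_isTypeIBlowup`: the Type-I rate gives a centred cubic ceiling

Work file of the stub worker for the Summit-side bridge of the c5 wave: a standing solution
(`ν = 1`, classical on `[0, T)`, Leray–Hopf, rapidly decaying datum) blowing up at the Type-I
rate `‖u(t, x)‖ ≤ C / √(T − t)` has `cknC r (T, x₀) u ≤ M₁` for all small `r`, at every `x₀`,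
GIVEN Seregin's "`L∞` Type-I rate ⇒ bounded scaled energies at the vertex" (Seregin 2014,
Prop. 3.11 (i)) as the hypothesis `hSE` (tree statement
`Literature.Analysis.FluidPDE.scaledEnergies_bounded_of_typeIRate`).
-/

noncomputable section

namespace Summit.NavierStokesRegularity.NavierStokesRegularity.Theorems

set_option linter.dupNamespace false

open MeasureTheory Filter Set Metric Function Topology TopologicalSpace
open scoped ENNReal NNReal
open Literature.Analysis.FluidPDE

/-- **The Type-I blow-up rate gives a centred cubic (`C`) ceiling at every final-time point**,
granted Seregin's "`L∞` Type-I rate on a parabolic cylinder ⇒ `A + E + C + D` bounded at its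
vertex" for suitable weak solutions (hypothesis `hSE`; Seregin 2014, Prop. 3.11 (i)).
Let `(u, p)` be classical on `ℝ³ × [0, T)` (`ν = 1`), Leray–Hopf on `[0, T]` from the rapidly
decaying datum `u 0`, with `‖u(t, x)‖ ≤ C / √(T − t)` for all `x` and all `t < T` close to `T`
(`IsTypeIBlowup u T`). Bridge past the final time: Leray's global weak solution `v` from `u 0`
with its Riesz pressure `q` is suitable on `(0, T+1) × ℝ³`
(`exists_isGlobalLerayHopf_and_isLocalEnergySolutionOn`), lies in `L³` resp. `L^{3/2}` of the
strip `(0, T) × ℝ³` (so `C(r₀; v), D(r₀; q) < ∞`), and coincides with `u` a.e. on the strip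
(weak–strong uniqueness, `weak_strong_uniqueness_holds`, strong class from
`tao2011_hasBoundedSobolevNormsOn.memLqLp_top`); hence `v` obeys `√(T − t) ‖v‖ ≤ C` a.e. on a
small backward cylinder `Q_{r₀}(T, x₀)`, `hSE` bounds `A + E + C + D ≤ K` on the cylinders of
radius `< r₀ / 2`, and `C(r; u) = C(r; v) ≤ K`.
[cite: Seregin2014, Prop. 3.11 (i)] [cite: SereginSverak2009, §1] -/
theorem stub_cknC_ceiling_of_isTypeIBlowup
    (hSE : ∀ (Q : TopologicalSpace.Opens (ℝ × EuclideanSpace ℝ (Fin 3)))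
      (u : ℝ → EuclideanSpace ℝ (Fin 3) → EuclideanSpace ℝ (Fin 3)) (p : ℝ → EuclideanSpace ℝ (Fin 3) → ℝ)
      (G : ℝ → EuclideanSpace ℝ (Fin 3) → EuclideanSpace ℝ (Fin 3) →L[ℝ] EuclideanSpace ℝ (Fin 3)),
      Literature.Analysis.FluidPDE.IsSuitableWeakSolutionOn Q 1 0 u p →
      Literature.Analysis.FluidPDE.HasWeakSpatialGradientOn Q u G →
      ∀ (z : ℝ × EuclideanSpace ℝ (Fin 3)) (r₀ : ℝ), 0 < r₀ →
      Literature.Analysis.FluidPDE.parabolicCylinder r₀ z ⊆ (Q : Set (ℝ × EuclideanSpace ℝ (Fin 3))) →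
      Literature.Analysis.FluidPDE.cknC r₀ z u ≠ ⊤ →
      Literature.Analysis.FluidPDE.cknD r₀ z p ≠ ⊤ →
      (∃ c : ℝ, ∀ᵐ w ∂(MeasureTheory.volume.restrict (Literature.Analysis.FluidPDE.parabolicCylinder r₀ z)),
        Real.sqrt (z.1 - w.1) * ‖u w.1 w.2‖ ≤ c) →
      ∃ K : NNReal, ∀ r ∈ Set.Ioo (0 : ℝ) (r₀ / 2),
        Literature.Analysis.FluidPDE.cknAEss r z u + Literature.Analysis.FluidPDE.cknE r z G +
          Literature.Analysis.FluidPDE.cknC r z u + Literature.Analysis.FluidPDE.cknD r z p ≤ K) :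
    ∀ T : ℝ, 0 < T → ∀ (u : ℝ → EuclideanSpace ℝ (Fin 3) → EuclideanSpace ℝ (Fin 3))
      (p : ℝ → EuclideanSpace ℝ (Fin 3) → ℝ),
      Literature.Analysis.FluidPDE.IsClassicalNSSolutionOn (Set.Ico 0 T) 1 0 u p →
      Literature.Analysis.FluidPDE.IsLerayHopfOn T 1 0 (u 0) u →
      Literature.Analysis.FluidPDE.HasRapidSpatialDecay (u 0) →
      Literature.Analysis.FluidPDE.IsTypeIBlowup u T →
      ∀ x₀ : EuclideanSpace ℝ (Fin 3), ∃ M₁ r₁ : ℝ, 0 < r₁ ∧ ∀ r ∈ Set.Ioo 0 r₁,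
        Literature.Analysis.FluidPDE.cknC r ((T, x₀) : ℝ × EuclideanSpace ℝ (Fin 3)) u ≤ ENNReal.ofReal M₁ := by
  intro T hT u p hcl hLH hdec hTI x₀
  -- ### the Leray continuation: a global suitable Leray–Hopf solution from `u 0`
  have hu0 : MemLp (u 0) 2 volume := hLH.memLp 0 ⟨le_rfl, hT.le⟩
  have hdiv : IsWeaklyDivFree (u 0) := hLH.isWeaklyDivFree_datum hT
  obtain ⟨v, q, hGL, -, hvmeas, -, hq32, hv3, hLE⟩ :=
    exists_isGlobalLerayHopf_and_isLocalEnergySolutionOn (zero_lt_one : (0 : ℝ) < 1) hu0 hdiv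
  -- ### weak–strong uniqueness on `[0, T']`, `T' < T`: `v(t) = u(t)` a.e. for `0 < t < T`
  have hslice : ∀ t ∈ Ioo 0 T, v t =ᵐ[volume] u t := by
    intro t ht
    have hT' : (t + T) / 2 ∈ Ioo 0 T := ⟨by linarith [ht.1], by linarith [ht.2]⟩
    have hS : MemLqLp ⊤ ⊤ u (Ioo 0 ((t + T) / 2)) :=
      tao2011_hasBoundedSobolevNormsOn.memLqLp_top tao2011_hasBoundedSobolevNormsOn_holds
        linfty_bound_of_hasBoundedSobolevNormsOn_holds 1 T zero_lt_one hT u p hcl hLH hdec _ hT'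
    have hu' : IsLerayHopfOn ((t + T) / 2) 1 0 (u 0) u := hLH.of_le hT'.2.le
    have hv' : IsLerayHopfOn ((t + T) / 2) 1 0 (u 0) v := hGL _ hT'.1
    have h3 : (3 : ℝ≥0∞) < ⊤ := ENNReal.ofNat_lt_top
    have hqr : 2 / (⊤ : ℝ≥0∞) + 3 / (⊤ : ℝ≥0∞) ≤ 1 := by simp
    exact weak_strong_uniqueness_holds zero_lt_one hT'.1 hu' h3 hqr hS hv' t
      ⟨ht.1, by linarith [ht.2]⟩
  -- ### space–time a.e. equality on the strip `(0, T) × ℝ³`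
  have hcont : ContinuousOn (uncurry u) (Ioo 0 T ×ˢ (univ : Set (EuclideanSpace ℝ (Fin 3)))) :=
    hcl.smooth_velocity.continuousOn.mono (Set.prod_mono Ioo_subset_Ico_self Subset.rfl)
  have humeas : AEStronglyMeasurable (uncurry u) (volume.restrict (Ioo 0 T ×ˢ (univ : Set (EuclideanSpace ℝ (Fin 3))))) :=
    hcont.aestronglyMeasurable (measurableSet_Ioo.prod MeasurableSet.univ)
  have hvmeas' : AEStronglyMeasurable (uncurry v)
      (volume.restrict (Ioo 0 T ×ˢ (univ : Set (EuclideanSpace ℝ (Fin 3))))) := by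
    have e : ((volume : Measure ℝ).restrict (Ioi 0)).prod (volume : Measure (EuclideanSpace ℝ (Fin 3))) =
        volume.restrict (Ioi (0 : ℝ) ×ˢ (univ : Set (EuclideanSpace ℝ (Fin 3)))) := by
      rw [Measure.volume_eq_prod, ← Measure.restrict_univ (μ := (volume : Measure (EuclideanSpace ℝ (Fin 3)))),
        Measure.prod_restrict, Measure.restrict_univ]
    rw [e] at hvmeas
    exact hvmeas.mono_measure
      (Measure.restrict_mono (Set.prod_mono Ioo_subset_Ioi_self Subset.rfl) le_rfl)
  have hae : uncurry v =ᵐ[volume.restrict (Ioo 0 T ×ˢ (univ : Set (EuclideanSpace ℝ (Fin 3))))] uncurry u :=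
    ae_restrict_prod_of_forall_ae_eq hslice hvmeas' humeas
  -- ### on the open slab `Q = (0, T+1) × ℝ³ ∋ (T, x₀)` the pair `(v, q)` is suitable
  have hsw : IsSuitableWeakSolutionOn (slab (EuclideanSpace ℝ (Fin 3)) (Ioo 0 (T + 1)) isOpen_Ioo) 1 0 v q :=
    (hLE (T + 1) (by linarith)).suitable
  obtain ⟨G, hGw, -, -⟩ := hsw.localEnergy
  -- backward cylinders of radius `r`, `r² < T`, lie in the strip `(0, T) × ℝ³`
  have hcylT : ∀ {r : ℝ}, r ^ 2 < T →
      parabolicCylinder r ((T, x₀) : ℝ × (EuclideanSpace ℝ (Fin 3))) ⊆ Ioo 0 T ×ˢ (univ : Set (EuclideanSpace ℝ (Fin 3))) := by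
    intro r hrT w hw
    rw [mem_parabolicCylinder] at hw
    have hw1 : T - r ^ 2 < w.1 := hw.1.1
    have hw2 : w.1 < T := hw.1.2
    exact ⟨⟨by linarith, hw2⟩, mem_univ _⟩
  -- ### the Type-I rate on a final time interval `(t₁, T)`, and a small radius `r₀`
  obtain ⟨C, hC⟩ := hTI
  obtain ⟨t₁, ht₁T, ht₁⟩ :
      ∃ t₁ : ℝ, t₁ < T ∧ ∀ t ∈ Ioo t₁ T, ∀ x, ‖u t x‖ ≤ C / Real.sqrt (T - t) := by
    obtain ⟨l, hl, hsub⟩ := mem_nhdsLT_iff_exists_Ioo_subset.1 hC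
    exact ⟨l, hl, fun t ht => hsub ht⟩
  set t₂ : ℝ := max t₁ 0 with ht₂
  have ht₂T : t₂ < T := max_lt ht₁T hT
  set d : ℝ := T - t₂ with hd
  have hd0 : 0 < d := by rw [hd]; linarith
  set r₀ : ℝ := Real.sqrt d / 2 with hr₀
  have hr₀0 : 0 < r₀ := div_pos (Real.sqrt_pos.2 hd0) two_pos
  have hr₀sq : r₀ ^ 2 = d / 4 := by
    rw [hr₀, div_pow, Real.sq_sqrt hd0.le]; norm_num
  -- `T - r² > t₂ ≥ max t₁ 0` for `0 < r ≤ r₀`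
  have hrd : ∀ {r : ℝ}, 0 < r → r ≤ r₀ → t₂ < T - r ^ 2 := by
    intro r hr hrr₀
    have h1 : r ^ 2 ≤ r₀ ^ 2 := pow_le_pow_left₀ hr.le hrr₀ 2
    rw [hr₀sq] at h1
    have h2 : d / 4 < d := by linarith
    rw [hd] at h1 h2
    linarith
  have hrT : ∀ {r : ℝ}, 0 < r → r ≤ r₀ → r ^ 2 < T := by
    intro r hr hrr₀
    have := hrd hr hrr₀
    have h0 : (0 : ℝ) ≤ t₂ := le_max_right _ _
    linarith
  have hr₀T : r₀ ^ 2 < T := hrT hr₀0 le_rfl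
  have hcylQ : parabolicCylinder r₀ ((T, x₀) : ℝ × (EuclideanSpace ℝ (Fin 3))) ⊆
      ((slab (EuclideanSpace ℝ (Fin 3)) (Ioo 0 (T + 1)) isOpen_Ioo : Opens (ℝ × (EuclideanSpace ℝ (Fin 3)))) : Set (ℝ × (EuclideanSpace ℝ (Fin 3)))) := by
    intro w hw
    have hw' := hcylT hr₀T hw
    show w ∈ Ioo 0 (T + 1) ×ˢ (univ : Set (EuclideanSpace ℝ (Fin 3)))
    exact ⟨⟨hw'.1.1, by linarith [hw'.1.2]⟩, mem_univ _⟩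
  -- ### `C(r₀; v) < ∞`, `D(r₀; q) < ∞`: `v ∈ L³`, `q ∈ L^{3/2}` of the strip
  have hCtop : cknC r₀ ((T, x₀) : ℝ × (EuclideanSpace ℝ (Fin 3))) v ≠ ∞ := by
    unfold cknC
    refine ENNReal.mul_ne_top ?_
      (lt_of_le_of_lt (lintegral_mono_set (hcylT hr₀T)) (hv3 T hT)).ne
    exact ENNReal.inv_ne_top.2 (pow_ne_zero _ (ENNReal.ofReal_pos.2 hr₀0).ne')
  have hDtop : cknD r₀ ((T, x₀) : ℝ × (EuclideanSpace ℝ (Fin 3))) q ≠ ∞ := by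
    unfold cknD
    refine ENNReal.mul_ne_top ?_
      (lt_of_le_of_lt (lintegral_mono_set (hcylT hr₀T)) (hq32 T hT)).ne
    exact ENNReal.inv_ne_top.2 (pow_ne_zero _ (ENNReal.ofReal_pos.2 hr₀0).ne')
  -- ### the rate `√(T - t) ‖v‖ ≤ C` a.e. on `Q_{r₀}(T, x₀)` (there `v = u` a.e. and `t₁ < t < T`)
  have hrate : ∀ᵐ w ∂(volume.restrict (parabolicCylinder r₀ ((T, x₀) : ℝ × (EuclideanSpace ℝ (Fin 3))))),
      Real.sqrt (((T, x₀) : ℝ × (EuclideanSpace ℝ (Fin 3))).1 - w.1) * ‖v w.1 w.2‖ ≤ C := by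
    have hae' : ∀ᵐ w ∂(volume.restrict (parabolicCylinder r₀ ((T, x₀) : ℝ × (EuclideanSpace ℝ (Fin 3))))),
        uncurry v w = uncurry u w :=
      ae_restrict_of_ae_restrict_of_subset (hcylT hr₀T) hae
    filter_upwards [hae', ae_restrict_mem (isOpen_parabolicCylinder r₀ _).measurableSet] with w hw hwQ
    have hw' : v w.1 w.2 = u w.1 w.2 := hw
    rw [mem_parabolicCylinder] at hwQ
    have hw1 : T - r₀ ^ 2 < w.1 := hwQ.1.1
    have hw2 : w.1 < T := hwQ.1.2
    have hwt₁ : t₁ < w.1 := lt_of_le_of_lt (le_max_left _ _) ((hrd hr₀0 le_rfl).trans hw1)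
    have hsq : 0 < Real.sqrt (T - w.1) := Real.sqrt_pos.2 (by linarith)
    have hb := ht₁ w.1 ⟨hwt₁, hw2⟩ w.2
    show Real.sqrt (T - w.1) * ‖v w.1 w.2‖ ≤ C
    rw [hw']
    calc Real.sqrt (T - w.1) * ‖u w.1 w.2‖
        ≤ Real.sqrt (T - w.1) * (C / Real.sqrt (T - w.1)) := mul_le_mul_of_nonneg_left hb hsq.le
      _ = C := by field_simp
  -- ### Seregin: bounded scaled energies of `(v, q)` at the vertex `(T, x₀)`
  obtain ⟨K, hK⟩ := hSE _ v q G hsw hGw ((T, x₀) : ℝ × (EuclideanSpace ℝ (Fin 3))) r₀ hr₀0 hcylQ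
    hCtop hDtop ⟨C, hrate⟩
  -- ### the ceiling for `u`: `C(r; u) = C(r; v) ≤ K` for `0 < r < r₀ / 2`
  refine ⟨((K : ℝ≥0) : ℝ), r₀ / 2, half_pos hr₀0, fun r hr => ?_⟩
  have hrr₀ : r ≤ r₀ := hr.2.le.trans (half_le_self hr₀0.le)
  have hae' : ∀ᵐ w ∂(volume.restrict (parabolicCylinder r ((T, x₀) : ℝ × (EuclideanSpace ℝ (Fin 3))))),
      uncurry v w = uncurry u w :=
    ae_restrict_of_ae_restrict_of_subset (hcylT (hrT hr.1 hrr₀)) hae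
  rw [← cknC_congr_ae hae', ENNReal.ofReal_coe_nnreal]
  exact (le_add_right (le_add_left le_rfl)).trans (hK r hr)

end Summit.NavierStokesRegularity.NavierStokesRegularity.Theorems

end
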